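import Summits.QuantumFields.YangMills.Theorems.BalabanUVNodesN08AxialDecimationFarFresh

/-!
# BalabanUVNodes ∕ N08 — FAR COARSE VARIABLES ARE FRESH FOR EVERY COARSE-GRAINING THAT IS AXIAL ON `Far`: file 36's locality engine for an ABSTRACT measurable map `Φ` from fine to
# coarse fields that coincides with the axial average on the far coarse bonds and whose other components ignore the far-selected bonds — the form in which the GUARDED maps of
# [Balaban1985Averaging] (15) (exp-mean-log correction on a fixed set of guarded bonds, axial elsewhere) consume it

Track A, DAG node N08 = T. Bałaban, CMP **102** (1985) 255–275 [Balaban1985UV3]: (2) p. 256, (10) p. 258, (48)–(49) p. 268; [Balaban1985Averaging] (15) p. 19; [Balaban1987RG1] (0.4)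
p. 253 (the small-field guard of the typed averaging).  Cell `pub-ymgap`, width seat `pub-ymgap-dag-n08-w1` (g6), W-SEAT-START-LIST §n08 item 1 successor piece (o29b) = file 36b;
`--supports` K1⁹ `StabilityBRunRowsAtRecordR13SepCoPHV` (stmt-QuantumFields-27364, KEY MAP v2; helper).  Companion of file 36 (`…N08AxialDecimationFarFresh`, the case `Φ = axial`;
its `integral_far_eq` and file 35's bookkeeping are imported BY NAME).

THE POINT (located, count-neutral).  `N08-NO-STACKING-MECHANISM.md` §3 (G1)–(G2): the transported GUARDED part must be shown LOCAL.  In positivity currency one bounds print's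
push-forward from above by a sum over guarded sets `A`: on «exactly `A` guarded» print's averaging IS the fixed map `Ū_A` (correction on `A`, axial elsewhere), and
`(μ↾{exactly A})∘Ū⁻¹ ≤ (μ↾G_A)∘Ū_A⁻¹`.  Each `Ū_A` is a coarse-graining of the kind treated here: axial on every coarse bond far from `A`, and near-local (its components off `Far`
read only the blocks around them).  THIS FILE proves, for every such abstract `Φ`: **conditionally on everything near, the far coarse variables are product Haar**
(`integral_mul_comp_eq_farAvg_of_coarseGraining`, `integral_mul_far_eq_of_coarseGraining`) — so `(ρ·1_{G_A}·dU)∘Ū_A⁻¹` is «(a measure on the near coarse bonds) ⊗ Haar^{Far}»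
whenever `ρ·1_{G_A}` ignores one bond per far line.  The a.e. density form (`T_Φ ρ =ᵐ A_Far(T_Φ ρ)` under `AvgAC Φ`) is in the companion `…N08AxialTransportFarIndependent`.

WHAT THIS FILE PROVES (kernel; theorems only, 0 def; [folklore] measure theory; nothing of the papers asserted).  Standing range; `Φ` measurable with (H_far) `Φ U c = axial U c`
(`c ∈ Far`) and (H_near) `Φ U c = Φ U′ c` (`c ∉ Far`) whenever `U`, `U′` agree off the far-selected bonds; `ρ` integrable, local off the far-selected bonds:
* ★★★ `integral_mul_far_eq_of_coarseGraining` — `∫ ρ·f₁(Φ U)·f₂(Φ U) dU = (∫ ρ·f₁(Φ U) dU)·(∫ f₂ dV)` (`f₁` local off `Far`, `f₂` local on `Far`, bounded measurable).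
* ★★★ `integral_mul_comp_eq_farAvg_of_coarseGraining` — `∫ ρ·f(Φ U) dU = ∫ ρ·(A_Far f)(Φ U) dU` (general bounded measurable `f`).

HONEST FRAMING: count-neutral helper; no map `Ū_A` is constructed here and no density bound is claimed — (a)′ ∕ (F) ∕ E6′ NOT decided; `PrintedUV3V` NOT proved; N08 NOT discharged;
one finite 𝕋⁴ programme at fixed ε, Bałaban AS PRINTED — R4 closes the conditional finite-𝕋⁴ rung `BalabanLadder.UV` only; the Yang–Mills mass gap (Clay) is NOT proved by any of
this; nothing continuum ∕ ℝ⁴ ∕ OS.  No `sorry`, standard axioms.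
-/

noncomputable section

open MeasureTheory
open scoped ENNReal

namespace Summit.QuantumFields.YangMills.BalabanUVNodes.N08CoarseGrainingFarFresh

open Literature.MathematicalPhysics.QuantumFieldTheory.Balaban1983to89
open Literature.MathematicalPhysics.QuantumFieldTheory.Balaban1983to89.AveragingRT
open Summit.QuantumFields.Balaban3D.Proofs
open Summit.QuantumFields.Balaban3D.Carriers
open Summit.QuantumFields.BalabanUV.T4Continuum.Spine.NE7 (line_inj)
open Summit.QuantumFields.YangMills.BalabanUVNodes.N08AxialDecimationForgetsSelected (pathProd_split splitEquiv_symm_apply piCongrLeft_const_apply)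

/-! ## Far coarse variables are fresh Haar for every coarse-graining axial on `Far` -/
section FarFresh

variable {P : Params} {j : ℕ} {G : Type} [GaugeGroup G] [MeasurableSpace G] [HaarData G] [MeasurableMul₂ G]

/-- ★★★ **FAR COARSE VARIABLES ARE FRESH HAAR FOR EVERY COARSE-GRAINING THAT IS AXIAL ON `Far`** (the locality engine in the form the guarded maps need): let `Φ` be ANY
measurable map from fine to coarse fields with `Φ U c = axial U c` for `c ∈ Far` and whose components OFF `Far` do not depend on the far-selected bonds (`τ` one bond per far line,
`τ c < L`); let the integrable density `ρ` not depend on the far-selected bonds either.  Then for every bounded measurable `f₁` local OFF `Far` and `f₂` local ON `Far`: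
`∫ ρ(U)·f₁(Φ U)·f₂(Φ U) dU = (∫ ρ(U)·f₁(Φ U) dU)·(∫ f₂ dV)` — the far coarse variables are product Haar, independent of the density and of the near components of `Φ`.  (File 36 =
`Φ = axial`; intended use: `Φ` = print's averaging with the exp-mean-log correction on a fixed guarded set `A` of bonds away from `Far`, axial elsewhere.)
[cite: Balaban1985UV3, (10) p.258 + (48)–(49) p.268 (bookkeeping); Balaban1985Averaging, (15) p.19; Balaban1987RG1, (0.4) p.253] -/
theorem integral_mul_far_eq_of_coarseGraining (hj : j + 1 ≤ P.m + P.K) (Far : PBond P (j + 1) → Prop) [DecidablePred Far] (τ : PBond P (j + 1) → ℕ) (hτ : ∀ c, Far c → τ c < P.L)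
    [DecidablePred fun b : PBond P j => ∃ c, Far c ∧ line c (τ c) = b]
    (Φ : GaugeField P j G → GaugeField P (j + 1) G) (hΦm : Measurable Φ) (hΦfar : ∀ U c, Far c → Φ U c = axialAvg U c)
    (hΦnear : ∀ U U' : GaugeField P j G, (∀ b, (¬ ∃ c, Far c ∧ line c (τ c) = b) → U b = U' b) → ∀ c, ¬ Far c → Φ U c = Φ U' c)
    (ρ : Density P j G) (hρ : Integrable ρ (fieldMeasure P j G))
    (hloc : ∀ W W' : GaugeField P j G, (∀ b, (¬ ∃ c, Far c ∧ line c (τ c) = b) → W b = W' b) → ρ W = ρ W')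
    (f₁ f₂ : GaugeField P (j + 1) G → ℝ) (hf₁ : Measurable f₁) (hf₂ : Measurable f₂) (C₁ C₂ : ℝ) (hC₁ : ∀ V, |f₁ V| ≤ C₁) (hC₂ : ∀ V, |f₂ V| ≤ C₂)
    (hloc₁ : ∀ V V' : GaugeField P (j + 1) G, (∀ c, ¬ Far c → V c = V' c) → f₁ V = f₁ V')
    (hloc₂ : ∀ V V' : GaugeField P (j + 1) G, (∀ c, Far c → V c = V' c) → f₂ V = f₂ V') :
    ∫ U, ρ U * (f₁ (Φ U) * f₂ (Φ U)) ∂(fieldMeasure P j G) =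
      (∫ U, ρ U * f₁ (Φ U) ∂(fieldMeasure P j G)) * ∫ V, f₂ V ∂(fieldMeasure P (j + 1) G) := by
  set B : PBond P j → Prop := fun b => ∃ c, Far c ∧ line c (τ c) = b with hB
  -- abbreviations for the join and its frozen version
  have hJ : ∀ (wZ : {b : PBond P j // ¬ B b} → G) (wB : {b : PBond P j // ¬¬ B b} → G) (b : PBond P j), ¬ B b →
      (FibreSplit.splitEquiv B (P := P) (G := G)).symm (wZ, wB) b = (FibreSplit.splitEquiv B (P := P) (G := G)).symm (wZ, fun _ => 1) b := by
    intro wZ wB b hb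
    rw [splitEquiv_symm_apply, splitEquiv_symm_apply, dif_pos hb, dif_pos hb]
  -- (i) `ρ` is frozen
  have hρc : ∀ (wZ : {b : PBond P j // ¬ B b} → G) (wB : {b : PBond P j // ¬¬ B b} → G),
      ρ ((FibreSplit.splitEquiv B (P := P) (G := G)).symm (wZ, wB)) = ρ ((FibreSplit.splitEquiv B (P := P) (G := G)).symm (wZ, fun _ => 1)) :=
    fun wZ wB => hloc _ _ fun b hb => hJ wZ wB b hb
  -- (ii) the non-far coarse variables are frozen: no bond of a non-far line is selected
  have hnotB : ∀ c, ¬ Far c → ∀ s, s < P.L → ¬ B (line c s) := by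
    rintro c hc s hs ⟨c', hc', h⟩
    obtain ⟨h1, -⟩ := line_inj hj (hτ c' hc') hs h
    exact hc (h1 ▸ hc')
  have hf₁c : ∀ (wZ : {b : PBond P j // ¬ B b} → G) (wB : {b : PBond P j // ¬¬ B b} → G),
      f₁ (Φ ((FibreSplit.splitEquiv B (P := P) (G := G)).symm (wZ, wB))) = f₁ (Φ ((FibreSplit.splitEquiv B (P := P) (G := G)).symm (wZ, fun _ => 1))) :=
    fun wZ wB => hloc₁ _ _ fun c hc => hΦnear _ _ (fun b hb => hJ wZ wB b hb) c hc
  -- (iii) the far coarse variables: reindexing + two-sided translation of fresh Haar variables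
  have hsel_inj : ∀ c c', Far c → Far c' → line c (τ c) = line c' (τ c') → c = c' :=
    fun c c' hc hc' h => (line_inj hj (hτ c hc) (hτ c' hc') h).1
  let e : {c : PBond P (j + 1) // ¬¬ Far c} ≃ {b : PBond P j // ¬¬ B b} :=
    Equiv.ofBijective (fun c => ⟨line c.1 (τ c.1), not_not.2 ⟨c.1, not_not.1 c.2, rfl⟩⟩)
      ⟨fun c c' h => Subtype.ext (hsel_inj c.1 c'.1 (not_not.1 c.2) (not_not.1 c'.2) (congrArg Subtype.val h)), fun b => by
        obtain ⟨c, hc, hcb⟩ := not_not.1 b.2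
        exact ⟨⟨c, not_not.2 hc⟩, Subtype.ext hcb⟩⟩
  choose a b hab hinv using fun c : {c : PBond P (j + 1) // ¬¬ Far c} => pathProd_split (P := P) (G := G) c.1 (hτ c.1 (not_not.1 c.2))
  have hfar : ∀ (wZ : {b : PBond P j // ¬ B b} → G),
      ∫ wB, f₂ (Φ ((FibreSplit.splitEquiv B (P := P) (G := G)).symm (wZ, wB))) ∂(Measure.pi fun _ : {b : PBond P j // ¬¬ B b} => (HaarData.haar : Measure G)) =
        ∫ V, f₂ V ∂(fieldMeasure P (j + 1) G) := by
    intro wZ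
    set W₀ : GaugeField P j G := (FibreSplit.splitEquiv B (P := P) (G := G)).symm (wZ, fun _ => 1) with hW₀
    -- the frozen non-far part of the coarse field
    let x₀ : {c : PBond P (j + 1) // ¬ Far c} → G := fun c => Φ W₀ c.1
    -- the far part as reindexing + translation
    let T : ({c : PBond P (j + 1) // ¬¬ Far c} → G) → ({c : PBond P (j + 1) // ¬¬ Far c} → G) := fun v c => a c W₀ * v c * b c W₀
    have hT : MeasurePreserving T (Measure.pi fun _ : {c : PBond P (j + 1) // ¬¬ Far c} => (HaarData.haar : Measure G))
        (Measure.pi fun _ : {c : PBond P (j + 1) // ¬¬ Far c} => (HaarData.haar : Measure G)) := by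
      have h1 := measurePreserving_pi (fun _ : {c : PBond P (j + 1) // ¬¬ Far c} => (HaarData.haar : Measure G)) (fun _ => HaarData.haar)
        (f := fun c x => a c W₀ * x) (fun c => ⟨measurable_const_mul _, HaarData.map_mul_left _⟩)
      have h2 := measurePreserving_pi (fun _ : {c : PBond P (j + 1) // ¬¬ Far c} => (HaarData.haar : Measure G)) (fun _ => HaarData.haar)
        (f := fun c x => x * b c W₀) (fun c => ⟨measurable_mul_const _, HaarData.map_mul_right _⟩)
      have hcomp : T = (fun (v : {c : PBond P (j + 1) // ¬¬ Far c} → G) c => v c * b c W₀) ∘ fun (v : {c : PBond P (j + 1) // ¬¬ Far c} → G) c => a c W₀ * v c := by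
        funext v c; rfl
      rw [hcomp]; exact h2.comp h1
    have hr : MeasurePreserving (⇑(MeasurableEquiv.piCongrLeft (fun _ : {c : PBond P (j + 1) // ¬¬ Far c} => G) e.symm))
        (Measure.pi fun _ : {b : PBond P j // ¬¬ B b} => (HaarData.haar : Measure G))
        (Measure.pi fun _ : {c : PBond P (j + 1) // ¬¬ Far c} => (HaarData.haar : Measure G)) :=
      measurePreserving_piCongrLeft (fun _ : {c : PBond P (j + 1) // ¬¬ Far c} => (HaarData.haar : Measure G)) e.symm
    -- the integrand factors through `joinC (x₀, T (r wB))`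
    have hfun : ∀ wB : {b : PBond P j // ¬¬ B b} → G,
        f₂ (Φ ((FibreSplit.splitEquiv B (P := P) (G := G)).symm (wZ, wB))) =
          f₂ ((FibreSplit.splitEquiv Far (P := P) (G := G)).symm (x₀, T (MeasurableEquiv.piCongrLeft (fun _ : {c : PBond P (j + 1) // ¬¬ Far c} => G) e.symm wB))) := by
      intro wB
      refine hloc₂ _ _ fun c hc => ?_
      rw [splitEquiv_symm_apply, dif_neg (not_not.2 hc)]
      show Φ _ c = a ⟨c, not_not.2 hc⟩ W₀ * (MeasurableEquiv.piCongrLeft (fun _ => G) e.symm wB) ⟨c, not_not.2 hc⟩ * b ⟨c, not_not.2 hc⟩ W₀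
      rw [hΦfar _ c hc, piCongrLeft_const_apply, Equiv.symm_symm]
      have hW : ∀ s, s < P.L → s ≠ τ c → ((FibreSplit.splitEquiv B (P := P) (G := G)).symm (wZ, wB)) (line c s) = W₀ (line c s) := by
        intro s hs hst
        refine hJ wZ wB _ ?_
        rintro ⟨c', hc', h⟩
        obtain ⟨h1, h2⟩ := line_inj hj (hτ c' hc') hs h
        subst h1
        exact hst h2.symm
      obtain ⟨ha', hb'⟩ := hinv ⟨c, not_not.2 hc⟩ _ _ hW
      rw [hab ⟨c, not_not.2 hc⟩, ha', hb']
      have hsel : ((FibreSplit.splitEquiv B (P := P) (G := G)).symm (wZ, wB)) (line c (τ c)) = wB (e ⟨c, not_not.2 hc⟩) := by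
        rw [splitEquiv_symm_apply, dif_neg (not_not.2 ⟨c, hc, rfl⟩)]
        rfl
      rw [hsel]
    simp_rw [hfun]
    have hmp := hT.comp hr
    have hmeas_g : Measurable fun v : {c : PBond P (j + 1) // ¬¬ Far c} → G => f₂ ((FibreSplit.splitEquiv Far (P := P) (G := G)).symm (x₀, v)) :=
      hf₂.comp ((FibreSplit.splitEquiv Far (P := P) (G := G)).symm.measurable.comp (measurable_const.prodMk measurable_id))
    rw [← N08AxialDecimationFarFresh.integral_far_eq Far f₂ hf₂ C₂ hC₂ hloc₂ x₀, ← hmp.map_eq, integral_map hmp.measurable.aemeasurable hmeas_g.aestronglyMeasurable]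
    rfl
  -- (iv) assemble by Fubini
  have hbd₁ : ∀ U, |f₁ (Φ U)| ≤ C₁ := fun U => hC₁ _
  have hint₁ : Integrable (fun U => ρ U * f₁ (Φ U)) (fieldMeasure P j G) :=
    hρ.mul_bdd (hf₁.comp hΦm).aestronglyMeasurable (Filter.Eventually.of_forall fun U => by rw [Real.norm_eq_abs]; exact hbd₁ U)
  have hint₁₂ : Integrable (fun U => ρ U * (f₁ (Φ U) * f₂ (Φ U))) (fieldMeasure P j G) := by
    refine hρ.mul_bdd ((hf₁.comp hΦm).mul (hf₂.comp hΦm)).aestronglyMeasurable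
      (c := C₁ * C₂) (Filter.Eventually.of_forall fun U => ?_)
    rw [Real.norm_eq_abs, abs_mul]
    have h0 : 0 ≤ C₁ := (abs_nonneg _).trans (hC₁ (Φ U))
    exact mul_le_mul (hC₁ _) (hC₂ _) (abs_nonneg _) h0
  rw [FibreSplit.integral_fieldMeasure_split B _ hint₁₂, FibreSplit.integral_fieldMeasure_split B _ hint₁]
  have hinner₁ : ∀ wZ : {b : PBond P j // ¬ B b} → G,
      ∫ wB, ρ ((FibreSplit.splitEquiv B (P := P) (G := G)).symm (wZ, wB)) * f₁ (Φ ((FibreSplit.splitEquiv B (P := P) (G := G)).symm (wZ, wB)))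
        ∂(Measure.pi fun _ : {b : PBond P j // ¬¬ B b} => (HaarData.haar : Measure G)) =
      ρ ((FibreSplit.splitEquiv B (P := P) (G := G)).symm (wZ, fun _ => 1)) * f₁ (Φ ((FibreSplit.splitEquiv B (P := P) (G := G)).symm (wZ, fun _ => 1))) := by
    intro wZ
    simp_rw [hρc wZ, hf₁c wZ]
    rw [integral_const, probReal_univ, one_smul]
  have hinner₁₂ : ∀ wZ : {b : PBond P j // ¬ B b} → G,
      ∫ wB, ρ ((FibreSplit.splitEquiv B (P := P) (G := G)).symm (wZ, wB)) *
          (f₁ (Φ ((FibreSplit.splitEquiv B (P := P) (G := G)).symm (wZ, wB))) * f₂ (Φ ((FibreSplit.splitEquiv B (P := P) (G := G)).symm (wZ, wB))))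
        ∂(Measure.pi fun _ : {b : PBond P j // ¬¬ B b} => (HaarData.haar : Measure G)) =
      ρ ((FibreSplit.splitEquiv B (P := P) (G := G)).symm (wZ, fun _ => 1)) * f₁ (Φ ((FibreSplit.splitEquiv B (P := P) (G := G)).symm (wZ, fun _ => 1))) *
        ∫ V, f₂ V ∂(fieldMeasure P (j + 1) G) := by
    intro wZ
    simp_rw [hρc wZ, hf₁c wZ, ← mul_assoc]
    rw [integral_const_mul, hfar wZ]
  simp_rw [hinner₁, hinner₁₂]
  rw [integral_mul_const]

/-- ★★★ **THE FAR-AVERAGE IDENTITY FOR EVERY COARSE-GRAINING AXIAL ON `Far`**: with `Φ`, `Far`, `τ`, `ρ` as above, for every bounded measurable coarse observable `f`: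
`∫ ρ(U)·f(Φ U) dU = ∫ ρ(U)·(A_Far f)(Φ U) dU`, `(A_Far f)(V) := ∫ f(V↾Farᶜ ⊔ v) dHaar^{Far}(v)` (written inline).  CONDITIONALLY ON EVERYTHING NEAR, the far coarse variables are
product Haar — for the axial average (file 36) and for every map that agrees with it on `Far` and is near-local off `Far`. [cite: Balaban1985UV3, (10) p.258 + (48)–(49) p.268 (bookkeeping); Balaban1985Averaging, (15) p.19; Balaban1987RG1, (0.4) p.253] -/
theorem integral_mul_comp_eq_farAvg_of_coarseGraining (hj : j + 1 ≤ P.m + P.K) (Far : PBond P (j + 1) → Prop) [DecidablePred Far] (τ : PBond P (j + 1) → ℕ)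
    (hτ : ∀ c, Far c → τ c < P.L) [DecidablePred fun b : PBond P j => ∃ c, Far c ∧ line c (τ c) = b]
    (Φ : GaugeField P j G → GaugeField P (j + 1) G) (hΦm : Measurable Φ) (hΦfar : ∀ U c, Far c → Φ U c = axialAvg U c)
    (hΦnear : ∀ U U' : GaugeField P j G, (∀ b, (¬ ∃ c, Far c ∧ line c (τ c) = b) → U b = U' b) → ∀ c, ¬ Far c → Φ U c = Φ U' c)
    (ρ : Density P j G) (hρ : Integrable ρ (fieldMeasure P j G))
    (hloc : ∀ W W' : GaugeField P j G, (∀ b, (¬ ∃ c, Far c ∧ line c (τ c) = b) → W b = W' b) → ρ W = ρ W')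
    (f : GaugeField P (j + 1) G → ℝ) (hf : Measurable f) (C : ℝ) (hC : ∀ V, |f V| ≤ C) :
    ∫ U, ρ U * f (Φ U) ∂(fieldMeasure P j G) =
      ∫ U, ρ U * (∫ v, f ((FibreSplit.splitEquiv Far (P := P) (G := G)).symm ((FibreSplit.splitEquiv Far (P := P) (G := G) (Φ U)).1, v))
        ∂(Measure.pi fun _ : {c : PBond P (j + 1) // ¬¬ Far c} => (HaarData.haar : Measure G))) ∂(fieldMeasure P j G) := by
  set B : PBond P j → Prop := fun b => ∃ c, Far c ∧ line c (τ c) = b with hB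
  -- the far-average as a function of the coarse field, bounded and measurable
  set Af : GaugeField P (j + 1) G → ℝ := fun V => ∫ v, f ((FibreSplit.splitEquiv Far (P := P) (G := G)).symm ((FibreSplit.splitEquiv Far (P := P) (G := G) V).1, v))
        ∂(Measure.pi fun _ : {c : PBond P (j + 1) // ¬¬ Far c} => (HaarData.haar : Measure G)) with hAf
  have hF : Measurable fun p : ({c : PBond P (j + 1) // ¬ Far c} → G) × ({c : PBond P (j + 1) // ¬¬ Far c} → G) =>
      f ((FibreSplit.splitEquiv Far (P := P) (G := G)).symm p) := hf.comp (FibreSplit.splitEquiv Far (P := P) (G := G)).symm.measurable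
  have hAf_meas : Measurable Af := by
    have h1 : StronglyMeasurable fun x : {c : PBond P (j + 1) // ¬ Far c} → G =>
        ∫ v, f ((FibreSplit.splitEquiv Far (P := P) (G := G)).symm (x, v)) ∂(Measure.pi fun _ : {c : PBond P (j + 1) // ¬¬ Far c} => (HaarData.haar : Measure G)) :=
      hF.stronglyMeasurable.integral_prod_right'
    exact h1.measurable.comp (measurable_fst.comp (FibreSplit.splitEquiv Far (P := P) (G := G)).measurable)
  have hAf_bdd : ∀ V, |Af V| ≤ C := by
    intro V
    have h0 : 0 ≤ C := (abs_nonneg _).trans (hC V)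
    refine (abs_integral_le_integral_abs).trans ?_
    calc ∫ v, |f ((FibreSplit.splitEquiv Far (P := P) (G := G)).symm ((FibreSplit.splitEquiv Far (P := P) (G := G) V).1, v))|
          ∂(Measure.pi fun _ : {c : PBond P (j + 1) // ¬¬ Far c} => (HaarData.haar : Measure G))
        ≤ ∫ _v, C ∂(Measure.pi fun _ : {c : PBond P (j + 1) // ¬¬ Far c} => (HaarData.haar : Measure G)) :=
          integral_mono_of_nonneg (Filter.Eventually.of_forall fun _ => abs_nonneg _) (integrable_const C)
            (Filter.Eventually.of_forall fun _ => hC _)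
      _ = C := by rw [integral_const, probReal_univ, one_smul]
  -- `Af` is local off `Far`: it reads `V` only through `V↾Farᶜ`
  have hAf_loc : ∀ V V' : GaugeField P (j + 1) G, (∀ c, ¬ Far c → V c = V' c) → Af V = Af V' := by
    intro V V' hVV'
    have : (FibreSplit.splitEquiv Far (P := P) (G := G) V).1 = (FibreSplit.splitEquiv Far (P := P) (G := G) V').1 := by
      funext c; exact hVV' c.1 c.2
    simp only [hAf, this]
  -- abbreviations for the fine join and its frozen version
  have hJ : ∀ (wZ : {b : PBond P j // ¬ B b} → G) (wB : {b : PBond P j // ¬¬ B b} → G) (b : PBond P j), ¬ B b →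
      (FibreSplit.splitEquiv B (P := P) (G := G)).symm (wZ, wB) b = (FibreSplit.splitEquiv B (P := P) (G := G)).symm (wZ, fun _ => 1) b := by
    intro wZ wB b hb
    rw [splitEquiv_symm_apply, splitEquiv_symm_apply, dif_pos hb, dif_pos hb]
  have hρc : ∀ (wZ : {b : PBond P j // ¬ B b} → G) (wB : {b : PBond P j // ¬¬ B b} → G),
      ρ ((FibreSplit.splitEquiv B (P := P) (G := G)).symm (wZ, wB)) = ρ ((FibreSplit.splitEquiv B (P := P) (G := G)).symm (wZ, fun _ => 1)) :=
    fun wZ wB => hloc _ _ fun b hb => hJ wZ wB b hb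
  have hnotB : ∀ c, ¬ Far c → ∀ s, s < P.L → ¬ B (line c s) := by
    rintro c hc s hs ⟨c', hc', h⟩
    obtain ⟨h1, -⟩ := line_inj hj (hτ c' hc') hs h
    exact hc (h1 ▸ hc')
  have hnear : ∀ (wZ : {b : PBond P j // ¬ B b} → G) (wB : {b : PBond P j // ¬¬ B b} → G) (c : PBond P (j + 1)), ¬ Far c →
      Φ ((FibreSplit.splitEquiv B (P := P) (G := G)).symm (wZ, wB)) c = Φ ((FibreSplit.splitEquiv B (P := P) (G := G)).symm (wZ, fun _ => 1)) c :=
    fun wZ wB c hc => hΦnear _ _ (fun b hb => hJ wZ wB b hb) c hc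
  have hAfc : ∀ (wZ : {b : PBond P j // ¬ B b} → G) (wB : {b : PBond P j // ¬¬ B b} → G),
      Af (Φ ((FibreSplit.splitEquiv B (P := P) (G := G)).symm (wZ, wB))) = Af (Φ ((FibreSplit.splitEquiv B (P := P) (G := G)).symm (wZ, fun _ => 1))) :=
    fun wZ wB => hAf_loc _ _ fun c hc => hnear wZ wB c hc
  -- the far coarse variables: reindexing + two-sided translation of fresh Haar variables
  have hsel_inj : ∀ c c', Far c → Far c' → line c (τ c) = line c' (τ c') → c = c' :=
    fun c c' hc hc' h => (line_inj hj (hτ c hc) (hτ c' hc') h).1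
  let e : {c : PBond P (j + 1) // ¬¬ Far c} ≃ {b : PBond P j // ¬¬ B b} :=
    Equiv.ofBijective (fun c => ⟨line c.1 (τ c.1), not_not.2 ⟨c.1, not_not.1 c.2, rfl⟩⟩)
      ⟨fun c c' h => Subtype.ext (hsel_inj c.1 c'.1 (not_not.1 c.2) (not_not.1 c'.2) (congrArg Subtype.val h)), fun b => by
        obtain ⟨c, hc, hcb⟩ := not_not.1 b.2
        exact ⟨⟨c, not_not.2 hc⟩, Subtype.ext hcb⟩⟩
  choose a b hab hinv using fun c : {c : PBond P (j + 1) // ¬¬ Far c} => pathProd_split (P := P) (G := G) c.1 (hτ c.1 (not_not.1 c.2))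
  -- KEY: the inner integral of `f(axial J)` over the far-selected variables is the far-average at the frozen field
  have hfar : ∀ (wZ : {b : PBond P j // ¬ B b} → G),
      ∫ wB, f (Φ ((FibreSplit.splitEquiv B (P := P) (G := G)).symm (wZ, wB))) ∂(Measure.pi fun _ : {b : PBond P j // ¬¬ B b} => (HaarData.haar : Measure G)) =
        ∫ v, f ((FibreSplit.splitEquiv Far (P := P) (G := G)).symm
          ((FibreSplit.splitEquiv Far (P := P) (G := G) (Φ ((FibreSplit.splitEquiv B (P := P) (G := G)).symm (wZ, fun _ => 1)))).1, v))
          ∂(Measure.pi fun _ : {c : PBond P (j + 1) // ¬¬ Far c} => (HaarData.haar : Measure G)) := by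
    intro wZ
    set W₀ : GaugeField P j G := (FibreSplit.splitEquiv B (P := P) (G := G)).symm (wZ, fun _ => 1) with hW₀
    let T : ({c : PBond P (j + 1) // ¬¬ Far c} → G) → ({c : PBond P (j + 1) // ¬¬ Far c} → G) := fun v c => a c W₀ * v c * b c W₀
    have hT : MeasurePreserving T (Measure.pi fun _ : {c : PBond P (j + 1) // ¬¬ Far c} => (HaarData.haar : Measure G))
        (Measure.pi fun _ : {c : PBond P (j + 1) // ¬¬ Far c} => (HaarData.haar : Measure G)) := by
      have h1 := measurePreserving_pi (fun _ : {c : PBond P (j + 1) // ¬¬ Far c} => (HaarData.haar : Measure G)) (fun _ => HaarData.haar)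
        (f := fun c x => a c W₀ * x) (fun c => ⟨measurable_const_mul _, HaarData.map_mul_left _⟩)
      have h2 := measurePreserving_pi (fun _ : {c : PBond P (j + 1) // ¬¬ Far c} => (HaarData.haar : Measure G)) (fun _ => HaarData.haar)
        (f := fun c x => x * b c W₀) (fun c => ⟨measurable_mul_const _, HaarData.map_mul_right _⟩)
      have hcomp : T = (fun (v : {c : PBond P (j + 1) // ¬¬ Far c} → G) c => v c * b c W₀) ∘ fun (v : {c : PBond P (j + 1) // ¬¬ Far c} → G) c => a c W₀ * v c := by
        funext v c; rfl
      rw [hcomp]; exact h2.comp h1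
    have hr : MeasurePreserving (⇑(MeasurableEquiv.piCongrLeft (fun _ : {c : PBond P (j + 1) // ¬¬ Far c} => G) e.symm))
        (Measure.pi fun _ : {b : PBond P j // ¬¬ B b} => (HaarData.haar : Measure G))
        (Measure.pi fun _ : {c : PBond P (j + 1) // ¬¬ Far c} => (HaarData.haar : Measure G)) :=
      measurePreserving_piCongrLeft (fun _ : {c : PBond P (j + 1) // ¬¬ Far c} => (HaarData.haar : Measure G)) e.symm
    -- the frozen near part is the first component of the split of `axial W₀`
    have hx₀ : ∀ wB : {b : PBond P j // ¬¬ B b} → G,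
        f (Φ ((FibreSplit.splitEquiv B (P := P) (G := G)).symm (wZ, wB))) =
          f ((FibreSplit.splitEquiv Far (P := P) (G := G)).symm ((FibreSplit.splitEquiv Far (P := P) (G := G) (Φ W₀)).1,
            T (MeasurableEquiv.piCongrLeft (fun _ : {c : PBond P (j + 1) // ¬¬ Far c} => G) e.symm wB))) := by
      intro wB
      congr 1
      funext c
      rw [splitEquiv_symm_apply]
      by_cases hc : ¬ Far c
      · rw [dif_pos hc]
        exact hnear wZ wB c hc
      · rw [dif_neg hc]
        have hc' : Far c := not_not.1 hc
        show Φ _ c = a ⟨c, hc⟩ W₀ * (MeasurableEquiv.piCongrLeft (fun _ => G) e.symm wB) ⟨c, hc⟩ * b ⟨c, hc⟩ W₀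
        rw [hΦfar _ c hc', piCongrLeft_const_apply, Equiv.symm_symm]
        have hW : ∀ s, s < P.L → s ≠ τ c → ((FibreSplit.splitEquiv B (P := P) (G := G)).symm (wZ, wB)) (line c s) = W₀ (line c s) := by
          intro s hs hst
          refine hJ wZ wB _ ?_
          rintro ⟨c', hc'', h⟩
          obtain ⟨h1, h2⟩ := line_inj hj (hτ c' hc'') hs h
          subst h1
          exact hst h2.symm
        obtain ⟨ha', hb'⟩ := hinv ⟨c, hc⟩ _ _ hW
        rw [hab ⟨c, hc⟩, ha', hb']
        have hsel : ((FibreSplit.splitEquiv B (P := P) (G := G)).symm (wZ, wB)) (line c (τ c)) = wB (e ⟨c, hc⟩) := by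
          rw [splitEquiv_symm_apply, dif_neg (not_not.2 ⟨c, hc', rfl⟩)]
          rfl
        rw [hsel]
    simp_rw [hx₀]
    have hmp := hT.comp hr
    have hmeas_g : Measurable fun v : {c : PBond P (j + 1) // ¬¬ Far c} → G =>
        f ((FibreSplit.splitEquiv Far (P := P) (G := G)).symm ((FibreSplit.splitEquiv Far (P := P) (G := G) (Φ W₀)).1, v)) :=
      hF.comp (measurable_const.prodMk measurable_id)
    rw [← hmp.map_eq, integral_map hmp.measurable.aemeasurable hmeas_g.aestronglyMeasurable]
    rfl
  -- assemble by Fubini on both sides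
  have hint : Integrable (fun U => ρ U * f (Φ U)) (fieldMeasure P j G) :=
    hρ.mul_bdd (hf.comp hΦm).aestronglyMeasurable (Filter.Eventually.of_forall fun U => by rw [Real.norm_eq_abs]; exact hC _)
  have hintA : Integrable (fun U => ρ U * Af (Φ U)) (fieldMeasure P j G) :=
    hρ.mul_bdd (hAf_meas.comp hΦm).aestronglyMeasurable (Filter.Eventually.of_forall fun U => by rw [Real.norm_eq_abs]; exact hAf_bdd _)
  show ∫ U, ρ U * f (Φ U) ∂(fieldMeasure P j G) = ∫ U, ρ U * Af (Φ U) ∂(fieldMeasure P j G)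
  rw [FibreSplit.integral_fieldMeasure_split B _ hint, FibreSplit.integral_fieldMeasure_split B _ hintA]
  refine integral_congr_ae (Filter.Eventually.of_forall fun wZ => ?_)
  show ∫ wB, ρ _ * f (Φ _) ∂_ = ∫ wB, ρ _ * Af (Φ _) ∂_
  simp_rw [hρc wZ, hAfc wZ]
  rw [integral_const_mul, hfar wZ, integral_const, probReal_univ, one_smul]

end FarFresh

end Summit.QuantumFields.YangMills.BalabanUVNodes.N08CoarseGrainingFarFresh

end
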